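import Summits.CriticalPhenomena.PercolationContinuityZ3.Theorems.SahiLiebSahiContinuum
import Literature.Probability.LatticeModels.MTP2FourFunctions

/-!
# Absolutely continuous measures on `Q_d`: the four functions theorem on the hypercube, FKG cell weights of a
# log-supermodular density, and the weighted Riemann sandwich (preliminaries)

Companion of `SahiLiebSahiContinuum.lean` / `SahiTwoDimDensity.lean` (cell `prim-sahi`, typer, generation 6;
`--supports stmt-CriticalPhenomena-4575`).  The `d`-dimensional version of the machinery of generation 5's
`SahiTwoDimDensity.lean` (`d = 2`), used by `SahiLiebSahiContinuumDensity.lean`: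

* `lintegral_four_functions_unitCube` — Karlin–Rinott's continuous four functions theorem on `Q_d = (Fin d → [0,1])`
  with Lebesgue measure (from the tree's `lintegral_four_functions` on `ℝ^ι`, along the coordinatewise clamp);
* `cubeCellWeight μ m` (masses of the `(m+1)^d` grid cells of `LebesgueCube.cubeCell`), `ex_cubeCellWeight`,
  `cubeCell_sup` / `cubeCell_inf` (the cell map is a lattice homomorphism),
  `isFKGMeasure_cubeCellWeight_withDensity` — the cell weights of an MTP₂ density form an FKG weight on `[m+1]^d`,
  `cubeCellWeight_withDensity_le` (bounded density ⇒ cell weights `≤ R`·Lebesgue);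
* the weighted sandwich `ex_loCube_le_integral`, `integral_le_ex_hiCube`, `ex_hiCube_sub_ex_loCube_le` (gap
  `≤ R·d·(g(1)−g(0))/(m+1)`, by `LebesgueCube.sum_gap_mul_le`), `integrable_of_monotone_of_absolutelyContinuous`,
  `tendsto_gridMoment`, and the criterion `msahiE_nonneg_of_cubeCellWeights` (Sahi positivity of order `n` of the
  cell weights on every box + `μ ≪ λ` + domination ⇒ Sahi positivity of order `n` of `μ`).
-/

noncomputable section

namespace Summit.CriticalPhenomena.PercolationContinuityZ3.Theorems.SahiCubeDensity

open MeasureTheory Set Filter Topology Finset Literature.Combinatorics.Sahi2008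
  Literature.Combinatorics.Sahi2008.LebesgueCube
open scoped unitInterval ENNReal NNReal

variable {d m : ℕ}

/-! ## The four functions theorem on `Q_d` -/

/-- The coordinatewise clamp `ℝ^d → Q_d`. [this work] -/
def clampCube (y : Fin d → ℝ) : Fin d → I := fun j => projIcc 0 1 zero_le_one (y j)

/-- The clamp preserves `⊔`. [this work] -/
theorem clampCube_sup (x y : Fin d → ℝ) : clampCube (x ⊔ y) = clampCube x ⊔ clampCube y := by
  funext j
  exact (monotone_projIcc (zero_le_one' ℝ)).map_sup (x j) (y j)

/-- The clamp preserves `⊓`. [this work] -/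
theorem clampCube_inf (x y : Fin d → ℝ) : clampCube (x ⊓ y) = clampCube x ⊓ clampCube y := by
  funext j
  exact (monotone_projIcc (zero_le_one' ℝ)).map_inf (x j) (y j)

/-- The clamp is measurable. [this work] -/
theorem measurable_clampCube : Measurable (clampCube (d := d)) :=
  measurable_pi_lambda _ fun j => continuous_projIcc.measurable.comp (measurable_pi_apply j)

/-- The clamp is a left inverse of the inclusion (plumbing). [this work] -/
private theorem clampCube_incl (x : Fin d → I) : clampCube (fun j => (x j : ℝ)) = x :=
  funext fun j => projIcc_val zero_le_one (x j)

/-- The inclusion `Q_d → ℝ^d` pushes Lebesgue measure to the product of the restricted Lebesgue measures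
(plumbing). [this work] -/
private theorem measurePreserving_incl :
    MeasurePreserving (fun (x : Fin d → I) (j : Fin d) => (x j : ℝ)) (volume : Measure (Fin d → I))
      (Measure.pi fun _ : Fin d => (volume : Measure ℝ).restrict (Icc (0 : ℝ) 1)) :=
  measurePreserving_pi (fun _ : Fin d => (volume : Measure I)) _ fun _ => unitInterval.measurePreserving_coe

/-- **The continuous four functions theorem on the unit hypercube** (Karlin–Rinott 1980, Thm. 2.1, for Lebesgue
measure on `Q_d`): if `f₁(x)f₂(y) ≤ f₃(x ∨ y)f₄(x ∧ y)` then `(∫f₁)(∫f₂) ≤ (∫f₃)(∫f₄)`.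
[cite: KarlinRinott1980, Thm. 2.1] -/
theorem lintegral_four_functions_unitCube (f₁ f₂ f₃ f₄ : (Fin d → I) → ℝ≥0∞) (hm₁ : Measurable f₁)
    (hm₂ : Measurable f₂) (hm₃ : Measurable f₃) (hm₄ : Measurable f₄)
    (h : ∀ x y, f₁ x * f₂ y ≤ f₃ (x ⊔ y) * f₄ (x ⊓ y)) :
    (∫⁻ x, f₁ x ∂(volume : Measure (Fin d → I))) * (∫⁻ x, f₂ x ∂(volume : Measure (Fin d → I))) ≤
      (∫⁻ x, f₃ x ∂(volume : Measure (Fin d → I))) * (∫⁻ x, f₄ x ∂(volume : Measure (Fin d → I))) := by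
  have tr : ∀ f : (Fin d → I) → ℝ≥0∞, Measurable f → ∫⁻ x, f x ∂(volume : Measure (Fin d → I)) =
      ∫⁻ y, (f ∘ clampCube) y ∂(Measure.pi fun _ : Fin d => (volume : Measure ℝ).restrict (Icc (0 : ℝ) 1)) := by
    intro f hf
    rw [← measurePreserving_incl.lintegral_comp (hf.comp measurable_clampCube)]
    refine lintegral_congr fun x => ?_
    simp only [Function.comp_apply, clampCube_incl]
  rw [tr f₁ hm₁, tr f₂ hm₂, tr f₃ hm₃, tr f₄ hm₄]
  exact Literature.Probability.LatticeModels.lintegral_four_functions _ _ _ _ _ (hm₁.comp measurable_clampCube)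
    (hm₂.comp measurable_clampCube) (hm₃.comp measurable_clampCube) (hm₄.comp measurable_clampCube)
    fun x y => by
      simp only [Function.comp_apply, clampCube_sup, clampCube_inf]
      exact h _ _

/-! ## Cell weights of a measure on `Q_d` -/

/-- The cell weights `w_m(c) = μ(cell c)` of a measure on `Q_d` for the `(m+1)^d` grid. [this work] -/
def cubeCellWeight (μ : Measure (Fin d → I)) (m : ℕ) : (Fin d → Fin (m + 1)) → ℝ :=
  fun c => μ.real (cubeCell m ⁻¹' {c})

/-- Cells are measurable (plumbing). [this work] -/
private theorem measurableSet_cell (c : Fin d → Fin (m + 1)) : MeasurableSet (cubeCell m ⁻¹' {c}) :=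
  (measurable_cubeCell m) (measurableSet_singleton c)

/-- Cell weights are nonnegative. [this work] -/
theorem cubeCellWeight_nonneg (μ : Measure (Fin d → I)) (c : Fin d → Fin (m + 1)) : 0 ≤ cubeCellWeight μ m c :=
  measureReal_nonneg

/-- The cell weights of a probability measure sum to one. [this work] -/
theorem sum_cubeCellWeight (μ : Measure (Fin d → I)) [IsProbabilityMeasure μ] : ∑ c, cubeCellWeight μ m c = 1 := by
  unfold cubeCellWeight
  rw [sum_measureReal_preimage_singleton univ (fun c _ => measurableSet_cell c), coe_univ, Set.preimage_univ,
    probReal_univ]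

/-- Expectations under the cell weights are integrals of grid step functions. [this work] -/
theorem ex_cubeCellWeight (μ : Measure (Fin d → I)) [IsFiniteMeasure μ] (γ : (Fin d → Fin (m + 1)) → ℝ) :
    ex (cubeCellWeight μ m) γ = ∫ x, γ (cubeCell m x) ∂μ := by
  have hγ : AEStronglyMeasurable γ (μ.map (cubeCell (d := d) m)) :=
    (measurable_of_countable γ).aestronglyMeasurable
  rw [← integral_map (measurable_cubeCell m).aemeasurable hγ,
    integral_fintype (Integrable.of_finite (μ := μ.map (cubeCell (d := d) m)) (f := γ)), ex]
  refine sum_congr rfl fun c _ => ?_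
  rw [map_measureReal_apply (measurable_cubeCell m) (measurableSet_singleton c), smul_eq_mul]
  rfl

/-- A grid step function is integrable under any finite measure (plumbing). [this work] -/
private theorem integrable_comp_cubeCell_measure (μ : Measure (Fin d → I)) [IsFiniteMeasure μ]
    (γ : (Fin d → Fin (m + 1)) → ℝ) : Integrable (fun x => γ (cubeCell m x)) μ :=
  (Integrable.of_finite (μ := μ.map (cubeCell (d := d) m)) (f := γ)).comp_measurable (measurable_cubeCell m)

/-- The cell index of `[0,1]` preserves `⊔` (plumbing, from the square). [this work] -/
private theorem cellIdx_sup (a b : I) : LebesgueSquare.cellIdx m (a ⊔ b) =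
    LebesgueSquare.cellIdx m a ⊔ LebesgueSquare.cellIdx m b :=
  congrArg Prod.fst (LebesgueSquare.cellPair_sup (m := m) (a, a) (b, b))

/-- The cell index of `[0,1]` preserves `⊓` (plumbing, from the square). [this work] -/
private theorem cellIdx_inf (a b : I) : LebesgueSquare.cellIdx m (a ⊓ b) =
    LebesgueSquare.cellIdx m a ⊓ LebesgueSquare.cellIdx m b :=
  congrArg Prod.fst (LebesgueSquare.cellPair_inf (m := m) (a, a) (b, b))

/-- **The cell map is a lattice homomorphism**: `cell(x ∨ y) = cell(x) ∨ cell(y)`. [this work] -/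
theorem cubeCell_sup (x y : Fin d → I) : cubeCell m (x ⊔ y) = cubeCell m x ⊔ cubeCell m y := by
  funext j
  exact cellIdx_sup (x j) (y j)

/-- `cell(x ∧ y) = cell(x) ∧ cell(y)`. [this work] -/
theorem cubeCell_inf (x y : Fin d → I) : cubeCell m (x ⊓ y) = cubeCell m x ⊓ cubeCell m y := by
  funext j
  exact cellIdx_inf (x j) (y j)

/-! ## Absolutely continuous FKG measures: the cell weights of a log-supermodular density are FKG -/

/-- The density restricted to a cell (plumbing). [this work] -/
private def cellDensity (ρ : (Fin d → I) → ℝ≥0∞) (m : ℕ) (c : Fin d → Fin (m + 1)) : (Fin d → I) → ℝ≥0∞ :=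
  (cubeCell m ⁻¹' {c}).indicator ρ

/-- The mass of a cell under `ρ·λ` (plumbing). [this work] -/
private theorem withDensity_cell (ρ : (Fin d → I) → ℝ≥0∞) (c : Fin d → Fin (m + 1)) :
    volume.withDensity ρ (cubeCell m ⁻¹' {c}) = ∫⁻ x, cellDensity ρ m c x ∂volume := by
  rw [withDensity_apply ρ (measurableSet_cell c), cellDensity, lintegral_indicator (measurableSet_cell c)]

/-- **The cell weights of a log-supermodular density on `Q_d` form an FKG weight on the box `[m+1]^d`**
(four functions theorem on `Q_d` applied to `ρ·1_{cell c}`, `ρ·1_{cell c'}`, `ρ·1_{cell c∨c'}`, `ρ·1_{cell c∧c'}`).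
[this work] -/
theorem isFKGMeasure_cubeCellWeight_withDensity (ρ : (Fin d → I) → ℝ≥0∞) (hρm : Measurable ρ)
    (hρ : ∀ x y, ρ x * ρ y ≤ ρ (x ⊔ y) * ρ (x ⊓ y)) [IsProbabilityMeasure (volume.withDensity ρ)] (m : ℕ) :
    IsFKGMeasure (cubeCellWeight (volume.withDensity ρ) m) where
  nonneg c := cubeCellWeight_nonneg _ c
  sum_eq_one := sum_cubeCellWeight _
  mul_le_mul c c' := by
    have hmeas : ∀ e : Fin d → Fin (m + 1), Measurable (cellDensity ρ m e) := fun e =>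
      hρm.indicator (measurableSet_cell e)
    have key := lintegral_four_functions_unitCube (cellDensity ρ m c) (cellDensity ρ m c')
      (cellDensity ρ m (c ⊔ c')) (cellDensity ρ m (c ⊓ c')) (hmeas c) (hmeas c') (hmeas _) (hmeas _)
      (fun x y => by
        unfold cellDensity
        by_cases hx : x ∈ cubeCell m ⁻¹' {c}
        · by_cases hy : y ∈ cubeCell m ⁻¹' {c'}
          · have hx' : cubeCell m x = c := hx
            have hy' : cubeCell m y = c' := hy
            have hsup : x ⊔ y ∈ cubeCell m ⁻¹' {c ⊔ c'} := by
              show cubeCell m (x ⊔ y) = c ⊔ c'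
              rw [cubeCell_sup, hx', hy']
            have hinf : x ⊓ y ∈ cubeCell m ⁻¹' {c ⊓ c'} := by
              show cubeCell m (x ⊓ y) = c ⊓ c'
              rw [cubeCell_inf, hx', hy']
            rw [indicator_of_mem hx, indicator_of_mem hy, indicator_of_mem hsup, indicator_of_mem hinf]
            exact hρ x y
          · rw [indicator_of_notMem hy, mul_zero]
            exact bot_le
        · rw [indicator_of_notMem hx, zero_mul]
          exact bot_le)
    have hfin : ∀ e : Fin d → Fin (m + 1), ∫⁻ x, cellDensity ρ m e x ∂volume ≠ ∞ := fun e => by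
      rw [← withDensity_cell]
      exact measure_ne_top _ _
    unfold cubeCellWeight
    simp only [measureReal_def, withDensity_cell]
    rw [← ENNReal.toReal_mul, ← ENNReal.toReal_mul, mul_comm (∫⁻ x, cellDensity ρ m (c ⊓ c') x ∂volume)]
    exact ENNReal.toReal_mono (ENNReal.mul_ne_top (hfin _) (hfin _)) key

/-- The cell weights of a bounded density are dominated by `(sup ρ)`·Lebesgue. [this work] -/
theorem cubeCellWeight_withDensity_le (ρ : (Fin d → I) → ℝ≥0∞) {R : ℝ≥0} (hρR : ∀ x, ρ x ≤ R) (m : ℕ)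
    (c : Fin d → Fin (m + 1)) :
    cubeCellWeight (volume.withDensity ρ) m c ≤ (R : ℝ) * cubeWeight d m c := by
  unfold cubeCellWeight
  rw [← volume_real_cubeCell_preimage c, measureReal_def, measureReal_def]
  have h : volume.withDensity ρ (cubeCell m ⁻¹' {c}) ≤ (R : ℝ≥0∞) * volume (cubeCell m ⁻¹' {c}) := by
    rw [withDensity_apply ρ (measurableSet_cell c), ← setLIntegral_const]
    exact setLIntegral_mono measurable_const fun x _ => hρR x
  have h' := ENNReal.toReal_mono (ENNReal.mul_ne_top ENNReal.coe_ne_top (measure_ne_top _ _)) h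
  rwa [ENNReal.toReal_mul, ENNReal.coe_toReal] at h'

/-! ## The weighted sandwich on `Q_d` -/

/-- Every point is below `(1,…,1)` (plumbing). [this work] -/
private theorem le_top' (x : Fin d → I) : x ≤ fun _ => 1 := fun j =>
  Subtype.coe_le_coe.1 (by rw [Set.Icc.coe_one]; exact (x j).2.2)

/-- Every point is above `(0,…,0)` (plumbing). [this work] -/
private theorem bot_le' (x : Fin d → I) : (fun _ => (0 : I)) ≤ x := fun j =>
  Subtype.coe_le_coe.1 (by rw [Set.Icc.coe_zero]; exact (x j).2.1)

/-- Lower sandwich: `Σ_c w(c) g(c⁻) ≤ ∫ g dμ` for a monotone `μ`-integrable `g`. [this work] -/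
theorem ex_loCube_le_integral (μ : Measure (Fin d → I)) [IsFiniteMeasure μ] {g : (Fin d → I) → ℝ}
    (hg : Monotone g) (hgi : Integrable g μ) : ex (cubeCellWeight μ m) (g ∘ loCube m) ≤ ∫ x, g x ∂μ := by
  rw [ex_cubeCellWeight]
  exact integral_mono (integrable_comp_cubeCell_measure μ _) hgi fun x => hg (loCube_cubeCell_le x)

/-- Upper sandwich: `∫ g dμ ≤ Σ_c w(c) g(c⁺)`. [this work] -/
theorem integral_le_ex_hiCube (μ : Measure (Fin d → I)) [IsFiniteMeasure μ] {g : (Fin d → I) → ℝ}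
    (hg : Monotone g) (hgi : Integrable g μ) : ∫ x, g x ∂μ ≤ ex (cubeCellWeight μ m) (g ∘ hiCube m) := by
  rw [ex_cubeCellWeight]
  exact integral_mono hgi (integrable_comp_cubeCell_measure μ _) fun x => hg (le_hiCube_cubeCell x)

/-- The sandwich closes when the cell weights are dominated by `R`·Lebesgue:
`Σ_c w(c)(g(c⁺) − g(c⁻)) ≤ R·d·(g(1,…,1) − g(0,…,0))/(m+1)` (`LebesgueCube.sum_gap_mul_le`). [this work] -/
theorem ex_hiCube_sub_ex_loCube_le (μ : Measure (Fin d → I)) {g : (Fin d → I) → ℝ} (hg : Monotone g) {R : ℝ}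
    (hR : ∀ c : Fin d → Fin (m + 1), cubeCellWeight μ m c ≤ R * cubeWeight d m c) :
    ex (cubeCellWeight μ m) (g ∘ hiCube m) - ex (cubeCellWeight μ m) (g ∘ loCube m) ≤
      R * (d : ℝ) * (g (fun _ => 1) - g (fun _ => 0)) / ((m : ℝ) + 1) := by
  have hT : (0 : ℝ) < (m : ℝ) + 1 := by positivity
  set B : ℝ := g (fun _ => 1) - g (fun _ => 0) with hB
  have hnn : ∀ c : Fin d → Fin (m + 1), 0 ≤ g (hiCube m c) - g (loCube m c) := fun c =>
    sub_nonneg.2 (hg (loCube_le_hiCube c))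
  have hdiff : ex (cubeCellWeight μ m) (g ∘ hiCube m) - ex (cubeCellWeight μ m) (g ∘ loCube m) =
      ∑ c, cubeCellWeight μ m c * (g (hiCube m c) - g (loCube m c)) := by
    rw [ex, ex, ← sum_sub_distrib]
    exact sum_congr rfl fun c _ => by simp only [Function.comp_apply]; ring
  have hgap := sum_gap_mul_le m d g hg
  have hRnn : 0 ≤ R := by
    have h0 := (cubeCellWeight_nonneg μ (fun _ => (0 : Fin (m + 1)))).trans (hR fun _ => 0)
    rw [cubeWeight_apply] at h0
    have hw : (0 : ℝ) < 1 / ((m : ℝ) + 1) ^ d := by positivity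
    nlinarith
  rw [hdiff]
  calc ∑ c, cubeCellWeight μ m c * (g (hiCube m c) - g (loCube m c))
      ≤ ∑ c, R * cubeWeight d m c * (g (hiCube m c) - g (loCube m c)) :=
        sum_le_sum fun c _ => mul_le_mul_of_nonneg_right (hR c) (hnn c)
    _ = R / ((m : ℝ) + 1) ^ d * ∑ c : Fin d → Fin (m + 1), (g (hiCube m c) - g (loCube m c)) := by
        rw [mul_sum]
        exact sum_congr rfl fun c _ => by rw [cubeWeight_apply]; ring
    _ ≤ R / ((m : ℝ) + 1) ^ d * ((d : ℝ) * ((m : ℝ) + 1) ^ d * B / ((m : ℝ) + 1)) := by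
        refine mul_le_mul_of_nonneg_left ?_ (by positivity)
        rw [le_div_iff₀ hT]
        exact hgap
    _ = R * (d : ℝ) * B / ((m : ℝ) + 1) := by
        field_simp

/-- A monotone function on `Q_d` is integrable for every finite measure absolutely continuous with respect to
Lebesgue measure (bounded, a.e. Borel). [this work] -/
theorem integrable_of_monotone_of_absolutelyContinuous (μ : Measure (Fin d → I)) [IsFiniteMeasure μ]
    (hμ : μ ≪ volume) {g : (Fin d → I) → ℝ} (hg : Monotone g) : Integrable g μ := by
  refine Integrable.mono' (integrable_const (|g fun _ => 0| + |g fun _ => 1|))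
    (hg.aestronglyMeasurable_unitCube.mono_ac hμ) (Eventually.of_forall fun x => ?_)
  rw [Real.norm_eq_abs]
  have hl := hg (bot_le' x)
  have hu := hg (le_top' x)
  rcases le_total 0 (g x) with h | h
  · rw [abs_of_nonneg h]
    linarith [le_abs_self (g fun _ => 1), abs_nonneg (g fun _ => 0)]
  · rw [abs_of_nonpos h]
    linarith [neg_abs_le (g fun _ => 0), abs_nonneg (g fun _ => 1)]

/-- A finite product of nonnegative monotone real functions is monotone (plumbing). [this work] -/
private theorem monotone_finset_prod {β : Type*} [Preorder β] {n : ℕ} {f : Fin n → β → ℝ}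
    (hf0 : ∀ i x, 0 ≤ f i x) (hmono : ∀ i, Monotone (f i)) (S : Finset (Fin n)) : Monotone (∏ i ∈ S, f i) := by
  classical
  induction S using Finset.induction_on with
  | empty =>
    rw [Finset.prod_empty]
    exact monotone_const
  | insert a S ha ih =>
    rw [Finset.prod_insert ha]
    exact (hmono a).mul ih (hf0 a) fun x => by
      rw [Finset.prod_apply]; exact prod_nonneg fun i _ => hf0 i x

variable {n : ℕ}

/-- **The joint moments of the grid family under the cell weights converge to the joint moments under `μ`**
(cell weights `≤ R`·Lebesgue, `μ ≪ λ`). [this work] -/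
theorem tendsto_gridMoment (μ : Measure (Fin d → I)) [IsProbabilityMeasure μ] (hμ : μ ≪ volume) {R : ℝ}
    (hR : ∀ m (c : Fin d → Fin (m + 1)), cubeCellWeight μ m c ≤ R * cubeWeight d m c)
    {f : Fin n → (Fin d → I) → ℝ} (hf0 : ∀ i x, 0 ≤ f i x) (hmono : ∀ i, Monotone (f i)) (S : Finset (Fin n)) :
    Tendsto (fun m => ex (cubeCellWeight μ m) (∏ i ∈ S, gridFam m f i)) atTop
      (𝓝 (∫ x, (∏ i ∈ S, f i) x ∂μ)) := by
  set g : (Fin d → I) → ℝ := ∏ i ∈ S, f i with hgdef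
  have hg : Monotone g := monotone_finset_prod hf0 hmono S
  have hgi : Integrable g μ := integrable_of_monotone_of_absolutelyContinuous μ hμ hg
  have hlo : ∀ m, ex (cubeCellWeight μ m) (∏ i ∈ S, gridFam m f i) = ex (cubeCellWeight μ m) (g ∘ loCube m) := by
    intro m
    congr 1
    funext c
    simp only [Finset.prod_apply, Function.comp_apply, gridFam, hgdef]
  simp only [hlo]
  set B : ℝ := g (fun _ => 1) - g (fun _ => 0) with hB
  have hlim0 : Tendsto (fun m : ℕ => (∫ x, g x ∂μ) - R * (d : ℝ) * B / ((m : ℝ) + 1)) atTop (𝓝 (∫ x, g x ∂μ)) := by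
    have h := (tendsto_const_div_atTop_nhds_zero_nat (R * (d : ℝ) * B)).comp (tendsto_add_atTop_nat 1)
    have h' : Tendsto (fun m : ℕ => R * (d : ℝ) * B / ((m : ℝ) + 1)) atTop (𝓝 0) := by
      refine h.congr fun m => ?_
      simp only [Function.comp_apply, Nat.cast_add, Nat.cast_one]
    simpa using (tendsto_const_nhds (x := ∫ x, g x ∂μ)).sub h'
  refine tendsto_of_tendsto_of_tendsto_of_le_of_le hlim0 tendsto_const_nhds (fun m => ?_) fun m => ?_
  · have h1 := integral_le_ex_hiCube (m := m) μ hg hgi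
    have h2 := ex_hiCube_sub_ex_loCube_le (m := m) μ hg (hR m)
    linarith
  · exact ex_loCube_le_integral μ hg hgi

/-- **Criterion.** A probability measure `μ ≪ λ` on `Q_d` whose cell weights are dominated by `R`·Lebesgue and are
Sahi-positive of order `n` on every box `[m+1]^d` is itself Sahi-positive of order `n` (continuity of the moment
polynomial). [this work] -/
theorem msahiE_nonneg_of_cubeCellWeights (μ : Measure (Fin d → I)) [IsProbabilityMeasure μ] (hμ : μ ≪ volume)
    {R : ℝ} (hR : ∀ m (c : Fin d → Fin (m + 1)), cubeCellWeight μ m c ≤ R * cubeWeight d m c)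
    (hpos : ∀ m, SahiPositive (cubeCellWeight μ m) n) (f : Fin n → (Fin d → I) → ℝ) (hf0 : ∀ i x, 0 ≤ f i x)
    (hmono : ∀ i, Monotone (f i)) : 0 ≤ msahiE μ n f := by
  set M : Finset (Fin n) → ℝ := fun S => ∫ x, (∏ i ∈ S, f i) x ∂μ with hM
  have hE : msahiE μ n f = momentE n M := msahiE_eq_momentE _ n f
  have hlim : Tendsto (fun m => momentE n fun S => ex (cubeCellWeight μ m) (∏ i ∈ S, gridFam m f i))
      atTop (𝓝 (momentE n M)) :=
    ((continuous_momentE n).tendsto M).comp (tendsto_pi_nhds.2 fun S => tendsto_gridMoment μ hμ hR hf0 hmono S)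
  have hnonneg : ∀ m, 0 ≤ momentE n fun S => ex (cubeCellWeight μ m) (∏ i ∈ S, gridFam m f i) := by
    intro m
    rw [← sahiE_eq_momentE]
    exact hpos m _ (gridFam_nonneg hf0 m) (gridFam_monotone hmono m)
  rw [hE]
  exact ge_of_tendsto' hlim hnonneg

end Summit.CriticalPhenomena.PercolationContinuityZ3.Theorems.SahiCubeDensity
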